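import Literature.IUT.HodgeTheaters.ProfiniteCompletionSurfaceBasisCharactersFcov
import Literature.IUT.HodgeTheaters.DiscreteProfiniteConjugatesThm26Closers
import Literature.IUT.HodgeTheaters.SurfaceGroupFiniteIndexBridge
import Literature.GroupTheory.CombinatorialGroupTheory.SurfaceGroupFiniteIndexSubgroupHolds
import HarnessLib

/-!
# The F-2733 consumer sweep of [IUTchI] §2 (L5 half): Theorem 2.6 / Corollary 2.8 / Lemma 2.7 (vi)(vii)
# modulo [Stb2] ALONE, the finite-index bridge and the p. 59 «no basis character» residual UNCONDITIONAL

Mochizuki, *Inter-universal Teichmüller theory I*, kurims manuscript (May 2020), §2, Lemma 2.7 (v)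
(statement p. 57, proof p. 59), Theorem 2.6 pp. 56–57, Corollary 2.8 p. 59 [cite: Mochizuki2012, Lem 2.7(v) p.59]
(D-0012 claim key, status disputed — everything here is classical (pro)finite group theory and takes no
side).  PROOF-ONLY file (theorems only; no `def`, no named fact, no instance), cell abc-iut (seat
abc-iut-w5-d200, D-0068 full-M discharge; DAG nodes `IUTchI:Thm2.6`, `IUTchI:Cor2.8`, `IUTchI:Lem2.7(vi)`,
`IUTchI:Lem2.7(vii)` and the p. 59 residual of `IUTchI:Lem2.7(v)`; FACT-LIST row F-2733).

The classical NAMED FACT `SurfaceGroupFiniteIndexSubgroup` (F-2733; Zieschang–Vogt–Coldewey LNM 835,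
Thm. 4.14.22 / Prop. 4.14.23: a subgroup of finite index `j` in the orientable surface group `S_g`,
`g ≥ 2`, is `≅ S_h` with `h = j (g - 1) + 1`) is now a THEOREM of the tree:
`Literature.GroupTheory.CombinatorialGroupTheory.surfaceGroupFiniteIndexSubgroup_holds`
(`SurfaceGroupFiniteIndexSubgroupHolds.lean`, abc-iut-L5-d3, Reidemeister–Schreier by coverings).
This file plugs that theorem into every [IUTchI] §2 consumer that carried it as the hypothesis binder
`(hF : SurfaceGroupFiniteIndexSubgroup)` / `(hFI : …)`, WITHOUT editing any file of another seat:

* (Lemma 2.7 (v) itself, `FreeOrSurface.zHatQuotientNormallyTerminal_holds`, is filed SEPARATELY by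
  abc-iut-w4-d053 as `ProfiniteCompletionLemma27v.lean` — that seat's announced one-liner over
  `zHatQuotientNormallyTerminal_of_finiteIndexSubgroup`; it is deliberately NOT duplicated here.)
* `ProfiniteCompletion.noBasisCharacter_of_isOrientableSurfaceGroup` — the p. 59 residual "NO BASIS
  CHARACTER" for orientable surface groups, unconditional;
* `IsOrientableSurfaceGroup.exists_genus_subgroup'`, `IsOrientableSurfaceGroup.subgroup_of_finiteIndex'`,
  `IsFreeOrSurface.subgroup_of_finiteIndex'` — the [IUTchI]-vocabulary transports of
  `SurfaceGroupFiniteIndexBridge.lean` (abc-iut-L5-d2), unconditional ("replacing `G` by an appropriate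
  finite index subgroup of `G`", p. 57);
* `FreeOrSurface.hcs_surface_of_conjugacySeparable`, `…profiniteConjugatesOfDiscreteSubgroups_of_conjugacySeparable`,
  `…subgroupsOfComplexHyperbolicPi1_of_conjugacySeparable`,
  `…centralizerCommutatorKernelTrivial_of_conjugacySeparable`,
  `…autFixingCommutatorKernelTrivial_of_conjugacySeparable` — Theorem 2.6 / Corollary 2.8 /
  Lemma 2.7 (vi)(vii) AS TYPED modulo **exactly ONE** classical named fact,
  `SurfaceGroupConjugacySeparable` (F-2732, [Stb2] = Stebe 1972 Thm. 3.3, the printed input of p. 57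
  l. 9), the second binder `hFI` of abc-iut-w5-d096's / abc-iut-L5-d2's `…_of_classicalFacts` /
  `…_of_facts` closers being DISCHARGED.

HONEST FRAMING: nothing here asserts abc proved or refuted; Theorem 2.6 and its corollaries remain
CONDITIONAL on F-2732 (typed ≠ proved for that fact); the free-group halves were already unconditional
(`DiscreteProfiniteCompletionsAssembly.lean`, abc-iut-L5-t9).
-/

namespace Literature.IUT.HodgeTheaters

open Literature.GroupTheory.CombinatorialGroupTheory

universe u

/-! ### The p. 59 residual of Lemma 2.7 (v): unconditional -/

namespace ProfiniteCompletion

variable {G : Type u} [Group G]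

/-- **NO BASIS CHARACTER for orientable surface groups — UNCONDITIONAL** (the p. 59 sentence "since
`T̂₁` is of infinite index in `Ĝ` … the `l`-cohomological dimension of `T̂₁` is `1`" in finite dress):
no open `U ⊆ Ĝ` carries a continuous `ψ : U → (ℤ/p)²` sending a COMMUTING pair `τ, κ` to a basis.
abc-iut-w4-d053's `noBasisCharacter_of_finiteIndexSubgroup` with its only hypothesis F_cov supplied by
the tree's theorem `surfaceGroupFiniteIndexSubgroup_holds`. [cite: Mochizuki2012, Lem 2.7(v) p.59] -/
theorem noBasisCharacter_of_isOrientableSurfaceGroup (hG : IsOrientableSurfaceGroup G) :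
    ∀ (p : ℕ), p.Prime → ∀ (U : Subgroup (profiniteCompletion G)),
      (∃ N₁ : FiniteIndexNormalSubgroup G, ∀ x : profiniteCompletion G, x.val N₁ = 1 → x ∈ U) →
      ∀ (ψ : U →* Multiplicative (ZMod p) × Multiplicative (ZMod p)),
      (∃ N₂ : FiniteIndexNormalSubgroup G,
        ∀ (x : profiniteCompletion G) (hx : x ∈ U), x.val N₂ = 1 → ψ ⟨x, hx⟩ = 1) →
      ∀ (τ κ : profiniteCompletion G) (hτ : τ ∈ U) (hκ : κ ∈ U), τ * κ = κ * τ →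
      ψ ⟨τ, hτ⟩ = (Multiplicative.ofAdd 1, 1) → ψ ⟨κ, hκ⟩ = (1, Multiplicative.ofAdd 1) → False :=
  noBasisCharacter_of_finiteIndexSubgroup surfaceGroupFiniteIndexSubgroup_holds hG

end ProfiniteCompletion

/-! ### "Replacing `G` by a finite-index subgroup": the bridge shapes, unconditional -/

/-- Riemann–Hurwitz genus bookkeeping for an abstract orientable surface group, UNCONDITIONAL: for
`G ≃* S_g` (`g ≥ 2`) and `H ≤ G` of finite index, `H ≃* S_h` with `h = [G:H]·(g-1)+1`
(abc-iut-L5-d2's `exists_genus_subgroup` at `surfaceGroupFiniteIndexSubgroup_holds`).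
[cite: ZieschangVogtColdewey1980, §4.14 Prop 4.14.23] -/
theorem IsOrientableSurfaceGroup.exists_genus_subgroup' {G : Type u} [Group G]
    (hG : IsOrientableSurfaceGroup G) (H : Subgroup G) [H.FiniteIndex] :
    ∃ g h : ℕ, 2 ≤ g ∧ h = H.index * (g - 1) + 1 ∧ Nonempty (G ≃* SurfaceGroup g) ∧
      Nonempty (H ≃* SurfaceGroup h) :=
  hG.exists_genus_subgroup surfaceGroupFiniteIndexSubgroup_holds H

/-- **A finite-index subgroup of an orientable surface group is an orientable surface group** —
UNCONDITIONAL ([IUTchI] Thm. 2.6 / Lem. 2.7 "replacing `G` by an appropriate finite index subgroup of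
`G`", p. 57). [cite: ZieschangVogtColdewey1980, §4.14 Prop 4.14.23] -/
theorem IsOrientableSurfaceGroup.subgroup_of_finiteIndex' {G : Type u} [Group G]
    (hG : IsOrientableSurfaceGroup G) (H : Subgroup G) [H.FiniteIndex] :
    IsOrientableSurfaceGroup H :=
  hG.subgroup_of_finiteIndex surfaceGroupFiniteIndexSubgroup_holds H

/-- The class "free of finite rank or orientable surface group" ("a group as in Theorem 2.6") is closed
under finite-index subgroups — UNCONDITIONAL. [cite: ZieschangVogtColdewey1980, §4.14 Prop 4.14.23] -/
theorem IsFreeOrSurface.subgroup_of_finiteIndex' {G : Type u} [Group G] (hG : IsFreeOrSurface G)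
    (H : Subgroup G) [H.FiniteIndex] : IsFreeOrSurface H :=
  hG.subgroup_of_finiteIndex surfaceGroupFiniteIndexSubgroup_holds H

/-! ### Theorem 2.6 / Corollary 2.8 / Lemma 2.7 (vi)(vii) modulo F-2732 alone -/

namespace FreeOrSurface

/-- **(HCS) for orientable surface groups modulo [Stb2] ALONE**: every finite-index subgroup of an
orientable surface group is conjugacy separable (finite-quotient form), GIVEN Stebe's theorem
`SurfaceGroupConjugacySeparable` (F-2732) — the Riemann–Hurwitz binder of `hcs_surface_of_classicalFacts`
is discharged by `surfaceGroupFiniteIndexSubgroup_holds`. [cite: Mochizuki2012, Thm 2.6 p.57] -/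
theorem hcs_surface_of_conjugacySeparable (hCS : SurfaceGroupConjugacySeparable) (S : Type u) [Group S]
    (hS : IsOrientableSurfaceGroup S) (K : Subgroup S) (hK : K.FiniteIndex) :
    ∀ u v : K, ¬ IsConj u v → ∃ (L : Subgroup K) (_ : L.Normal) (_ : L.FiniteIndex),
      ¬ IsConj (QuotientGroup.mk u : K ⧸ L) (QuotientGroup.mk v) :=
  hcs_surface_of_classicalFacts hCS surfaceGroupFiniteIndexSubgroup_holds S hS K hK

/-- **[IUTchI] Theorem 2.6 (Profinite Conjugates of Discrete Subgroups) AS TYPED, modulo exactly ONE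
classical named fact** — `SurfaceGroupConjugacySeparable` ([Stb2] Thm. 3.3, the printed input p. 57
l. 9); Lemma 2.7 (i)(iii)(iv) and F-2733 are theorems of the tree. [cite: Mochizuki2012, Thm 2.6 pp.56-57] -/
theorem profiniteConjugatesOfDiscreteSubgroups_of_conjugacySeparable
    (hCS : SurfaceGroupConjugacySeparable) :
    Literature.IUT.HodgeTheaters.ProfiniteConjugatesOfDiscreteSubgroups.{u} :=
  profiniteConjugatesOfDiscreteSubgroups_of_classicalFacts hCS surfaceGroupFiniteIndexSubgroup_holds

/-- **[IUTchI] Corollary 2.8 (Subgroups of Topological Fundamental Groups of Complex Hyperbolic Curves)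
AS TYPED, modulo exactly `SurfaceGroupConjugacySeparable`** (Remark 2.8.1: immediate from Theorem 2.6).
[cite: Mochizuki2012, Cor 2.8 p.59] -/
theorem subgroupsOfComplexHyperbolicPi1_of_conjugacySeparable (hCS : SurfaceGroupConjugacySeparable) :
    Literature.IUT.HodgeTheaters.SubgroupsOfComplexHyperbolicPi1.{u} :=
  subgroupsOfComplexHyperbolicPi1_of_classicalFacts hCS surfaceGroupFiniteIndexSubgroup_holds

/-- **[IUTchI] Lemma 2.7 (vi) AS TYPED (`Z_Ĝ(N̂)` trivial for `N̂ = Ker(Ĝ ↠ Ĝ^{ab})`), modulo exactly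
`SurfaceGroupConjugacySeparable`.** [cite: Mochizuki2012, Lem 2.7(vi) p.58] -/
theorem centralizerCommutatorKernelTrivial_of_conjugacySeparable
    (hCS : SurfaceGroupConjugacySeparable) :
    Literature.IUT.HodgeTheaters.FreeOrSurface.centralizerCommutatorKernelTrivial.{u} :=
  centralizerCommutatorKernelTrivial_of_classicalFacts hCS surfaceGroupFiniteIndexSubgroup_holds

/-- **[IUTchI] Lemma 2.7 (vii) AS TYPED (an automorphism of `Ĝ` fixing `N̂` pointwise is the identity),
modulo exactly `SurfaceGroupConjugacySeparable`.** [cite: Mochizuki2012, Lem 2.7(vii) p.58] -/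
theorem autFixingCommutatorKernelTrivial_of_conjugacySeparable (hCS : SurfaceGroupConjugacySeparable) :
    Literature.IUT.HodgeTheaters.FreeOrSurface.autFixingCommutatorKernelTrivial.{u} :=
  autFixingCommutatorKernelTrivial_of_classicalFacts hCS surfaceGroupFiniteIndexSubgroup_holds

end FreeOrSurface

end Literature.IUT.HodgeTheaters
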